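import Summits.ValiantsHypothesis.ValiantsHypothesis.Theses.UnpaddedGIT
import Literature.Computability.AlgebraicComplexity.PencilFamily
import Literature.Computability.AlgebraicComplexity.OrbitClosureProofs

/-!
# Route UnpaddedGIT — support item `Completeness` (stmt-ValiantsHypothesis-5765)

Obstructions exist iff the separation holds. With (i) polystability of `per_n` (the image under
`coeffVec` of the `SL_(n²)`-orbit of `per_n` is Zariski closed) and (ii) Mumford separation
(disjoint Zariski-closed `SL_(n²)`-stable subsets of degree-`n` forms are separated by an
invariant taking the values `0` and `1`) — both inlined as hypotheses of the item — the
non-membership of `per_n` in the Zariski closure of the pencil-coefficient family `D_m(n)` yields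
an `SL_(n²)`-invariant polynomial on degree-`n` forms vanishing on `D_m(n)` and not at `per_n`.

The bookkeeping proved here: `D_m(n)` is stable under every linear substitution
(`linSubst_mem_pencilCoeffFamily`), hence so is its Zariski closure in coefficient space (pull
back test polynomials along the linear action, `aeval_coeffVec_linSubstPullback`); that closure
consists of coefficient vectors of degree-`n` forms (the coordinates `X_d`, `|d| ≠ n`, vanish on
it and `σ = Fin n × Fin n` is finite); the `SL`-orbit of `per_n` is `SL`-stable, consists of
degree-`n` forms and is disjoint from the closure (translate an orbit point back by `g⁻¹`).
Mumford's hypothesis applied to `Z₁ = closure (coeffVec '' D_m(n))`, `Z₂ = coeffVec '' (SL · per_n)`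
gives the invariant `F` with `F = 0` on `D_m(n)` and `F (per_n) = 1 ≠ 0`.

References: Mumford–Fogarty–Kirwan 1994, Ch. 1 §2, Cor. 1.2; Bürgisser–Ikenmeyer 2017
(arXiv:1511.02927) Cor. 2.9, §3; Derksen–Kemper 2015 §2.3.
-/

namespace Summit.ValiantsHypothesis.ValiantsHypothesis.Theorems

set_option linter.dupNamespace false

open MvPolynomial Literature.Computability.AlgebraicComplexity

/-- The Zariski closure, in coefficient space, of the pencil-coefficient family `D_m(n)` is stable
under every linear substitution of the variables (on coefficient vectors of polynomials): a test
polynomial vanishing on `coeffVec '' D_m(n)` pulls back along the (linear) action of `B` to a test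
polynomial vanishing there as well, because `D_m(n)` itself is `B`-stable.
Mulmuley–Sohoni 2001 §4; Bürgisser–Ikenmeyer 2017 §3. -/
theorem coeffVec_linSubst_mem_zariskiClosure_pencilFamily {n m : ℕ}
    (B : Matrix (Fin n × Fin n) (Fin n × Fin n) ℂ) {f : MvPolynomial (Fin n × Fin n) ℂ}
    (hf : coeffVec f ∈ zariskiClosure (coeffVec '' pencilFamily n m)) :
    coeffVec (linSubst (Fin n × Fin n) ℂ B f) ∈ zariskiClosure (coeffVec '' pencilFamily n m) := by
  rw [mem_zariskiClosure_iff] at hf ⊢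
  intro p hp
  rw [← aeval_coeffVec_linSubstPullback]
  apply hf
  rintro _ ⟨g, hg, rfl⟩
  rw [aeval_coeffVec_linSubstPullback]
  exact hp _ ⟨_, linSubst_mem_pencilCoeffFamily B hg, rfl⟩

/-- The Zariski closure of `coeffVec '' D_m(n)` consists of coefficient vectors of forms of degree
`n`: each coordinate function `X_d` with `|d| ≠ n` vanishes on `D_m(n) ⊆ Sym^n`, hence on the
closure, and a vector supported on the (finitely many) degree-`n` monomials is the coefficient
vector of a degree-`n` form. Mulmuley–Sohoni 2001 §4 (`V = Sym^n`). -/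
theorem zariskiClosure_pencilFamily_subset_image_isHomogeneous (n m : ℕ) :
    zariskiClosure (coeffVec '' pencilFamily n m) ⊆
      coeffVec '' {f : MvPolynomial (Fin n × Fin n) ℂ | f.IsHomogeneous n} := by
  intro v hv
  rw [mem_zariskiClosure_iff] at hv
  have hvd : ∀ d : (Fin n × Fin n) →₀ ℕ, d.degree ≠ n → v d = 0 := by
    intro d hd
    have h := hv (X d) (by
      rintro _ ⟨g, hg, rfl⟩
      rw [aeval_X, coeffVec_apply]
      exact (isHomogeneous_of_mem_pencilCoeffFamily hg).coeff_eq_zero hd)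
    simpa using h
  have hmem : ∀ e : (Fin n × Fin n) →₀ ℕ,
      e ∈ (Finset.univ : Finset (Fin n × Fin n)).finsuppAntidiag n ↔ e.degree = n := by
    intro e
    simp [Finset.mem_finsuppAntidiag, Finsupp.degree_eq_sum]
  refine ⟨∑ e ∈ (Finset.univ : Finset (Fin n × Fin n)).finsuppAntidiag n, monomial e (v e),
    IsHomogeneous.sum _ _ _ fun e he => isHomogeneous_monomial _ ((hmem e).mp he), ?_⟩
  funext d
  simp only [coeffVec_apply, coeff_sum, coeff_monomial, Finset.sum_ite_eq']
  split_ifs with h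
  · rfl
  · exact (hvd d fun hd => h ((hmem d).mpr hd)).symm

/-- The `SL_(n²)`-orbit of `per_n` (as inlined in the item) is `SL_(n²)`-stable on coefficient
vectors: `g · (g' · per_n) = (g g') · per_n` (`linSubst_mul`). Bürgisser–Ikenmeyer 2017 §2. -/
theorem coeffVec_linSubst_mem_image_slOrbit_perPoly {n : ℕ}
    (g : Matrix.SpecialLinearGroup (Fin n × Fin n) ℂ) {f : MvPolynomial (Fin n × Fin n) ℂ}
    (hf : coeffVec f ∈ coeffVec '' {h : MvPolynomial (Fin n × Fin n) ℂ |
      ∃ g : Matrix.SpecialLinearGroup (Fin n × Fin n) ℂ,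
        h = linSubst (Fin n × Fin n) ℂ (g : Matrix (Fin n × Fin n) (Fin n × Fin n) ℂ)
          (perPoly (Fin n) ℂ)}) :
    coeffVec (linSubst (Fin n × Fin n) ℂ (g : Matrix (Fin n × Fin n) (Fin n × Fin n) ℂ) f) ∈
      coeffVec '' {h : MvPolynomial (Fin n × Fin n) ℂ |
        ∃ g : Matrix.SpecialLinearGroup (Fin n × Fin n) ℂ,
          h = linSubst (Fin n × Fin n) ℂ (g : Matrix (Fin n × Fin n) (Fin n × Fin n) ℂ)
            (perPoly (Fin n) ℂ)} := by
  obtain ⟨h, ⟨g', rfl⟩, hh⟩ := hf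
  obtain rfl := coeffVec_injective hh
  refine ⟨_, ⟨g * g', ?_⟩, rfl⟩
  rw [Matrix.SpecialLinearGroup.coe_mul, linSubst_mul, AlgHom.comp_apply]

/-- If `per_n` is not in the Zariski closure of `coeffVec '' D_m(n)`, then the whole `SL_(n²)`-orbit
of `per_n` misses that closure (the closure is `SL`-stable: translate back by `g⁻¹`).
Bürgisser–Ikenmeyer 2017 §3; Mumford–Fogarty–Kirwan 1994 Ch. 1 §2. -/
theorem disjoint_zariskiClosure_pencilFamily_image_slOrbit_perPoly {n m : ℕ}
    (hper : coeffVec (perPoly (Fin n) ℂ) ∉ zariskiClosure (coeffVec '' pencilFamily n m)) :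
    Disjoint (zariskiClosure (coeffVec '' pencilFamily n m))
      (coeffVec '' {h : MvPolynomial (Fin n × Fin n) ℂ |
        ∃ g : Matrix.SpecialLinearGroup (Fin n × Fin n) ℂ,
          h = linSubst (Fin n × Fin n) ℂ (g : Matrix (Fin n × Fin n) (Fin n × Fin n) ℂ)
            (perPoly (Fin n) ℂ)}) := by
  rw [Set.disjoint_left]
  rintro v hv ⟨h, ⟨g, rfl⟩, rfl⟩
  apply hper
  have key := coeffVec_linSubst_mem_zariskiClosure_pencilFamily
    ((g⁻¹ : Matrix.SpecialLinearGroup (Fin n × Fin n) ℂ) :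
      Matrix (Fin n × Fin n) (Fin n × Fin n) ℂ) hv
  rw [← AlgHom.comp_apply, ← linSubst_mul, ← Matrix.SpecialLinearGroup.coe_mul, inv_mul_cancel,
    Matrix.SpecialLinearGroup.coe_one, linSubst_one, AlgHom.id_apply] at key
  exact key

/-- The `SL_(n²)`-orbit of `per_n` consists of forms of degree `n` (`per_n` is a form of degree
`n`, `perPoly_isHomogeneous`, and linear substitution preserves degrees, `linSubst_isHomogeneous`).
Bürgisser–Ikenmeyer 2017 §2. -/
theorem image_slOrbit_perPoly_subset_image_isHomogeneous (n : ℕ) :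
    coeffVec '' {h : MvPolynomial (Fin n × Fin n) ℂ |
        ∃ g : Matrix.SpecialLinearGroup (Fin n × Fin n) ℂ,
          h = linSubst (Fin n × Fin n) ℂ (g : Matrix (Fin n × Fin n) (Fin n × Fin n) ℂ)
            (perPoly (Fin n) ℂ)} ⊆
      coeffVec '' {f : MvPolynomial (Fin n × Fin n) ℂ | f.IsHomogeneous n} := by
  have hperHom : (perPoly (Fin n) ℂ).IsHomogeneous n := by
    simpa using perPoly_isHomogeneous (n := Fin n) (k := ℂ)
  rintro _ ⟨h, ⟨g, rfl⟩, rfl⟩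
  exact ⟨_, linSubst_isHomogeneous _ hperHom, rfl⟩

/-- **Support item `Completeness` of route UnpaddedGIT** (obstructions exist iff the separation
holds). Given, as inlined hypotheses, (i) polystability of `per_n` — the `SL_(n²)`-orbit of `per_n`
has Zariski-closed image in coefficient space (Bürgisser–Ikenmeyer 2017 Cor. 2.9) — and
(ii) Mumford separation for `SL_(n²)` acting on degree-`n` forms (disjoint Zariski-closed
`SL`-stable subsets are separated by an invariant with values `0` and `1`;
Mumford–Fogarty–Kirwan 1994 Ch. 1 §2 Cor. 1.2, Derksen–Kemper 2015 §2.3), if `per_n` is not in the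
Zariski closure of `coeffVec '' D_m(n)` then there is a polynomial `F` on coefficient space,
`SL_(n²)`-invariant on degree-`n` forms, vanishing at `hc_n (det A)` for every `m × m` matrix `A` of
affine linear forms, with `F (per_n) ≠ 0`. Proof: apply (ii) to
`Z₁ = closure (coeffVec '' D_m(n))` and `Z₂ = coeffVec '' (SL · per_n)`. -/
theorem completeness_proof :
    Summit.ValiantsHypothesis.ValiantsHypothesis.Theses.UnpaddedGIT.Completeness := by
  unfold Summit.ValiantsHypothesis.ValiantsHypothesis.Theses.UnpaddedGIT.Completeness
  intro n hpoly hsep m hper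
  obtain ⟨F, hFinv, hF0, hF1⟩ := hsep _ _ (zariskiClosure_zariskiClosure _)
    (Set.Subset.antisymm hpoly (subset_zariskiClosure _))
    (zariskiClosure_pencilFamily_subset_image_isHomogeneous n m)
    (image_slOrbit_perPoly_subset_image_isHomogeneous n)
    (fun g _ hf => coeffVec_linSubst_mem_zariskiClosure_pencilFamily _ hf)
    (fun g _ hf => coeffVec_linSubst_mem_image_slOrbit_perPoly g hf)
    (disjoint_zariskiClosure_pencilFamily_image_slOrbit_perPoly hper)
  refine ⟨F, hFinv, fun A hA => hF0 _ (subset_zariskiClosure _ ⟨_, ⟨A, hA, rfl⟩, rfl⟩), ?_⟩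
  rw [hF1 _ ⟨_, ⟨1, by rw [Matrix.SpecialLinearGroup.coe_one, linSubst_one]; rfl⟩, rfl⟩]
  exact one_ne_zero

end Summit.ValiantsHypothesis.ValiantsHypothesis.Theorems
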